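import Summits.QuantumFields.YangMills.Theorems.FluctuationComparisonRegPrIntLPolymerMayerGas
import Summits.QuantumFields.YangMills.Theorems.FluctuationComparisonRegPrIntLBackgroundFormCauchyShape
import HarnessLib

/-!
# THE LAST MAYER STEP ON T³ — FAMILIES EDITION: ARBITRARY WINDOW PAIRS (one complex parameter) AND SQUARES OF FOUR CORNERS (two complex parameters, slice-analytic)

Cell `ym3-torus` (YM ladder rung R3 = continuum `SU(2)` Yang–Mills on the three-torus — a RUNG, NOT d = 4, NOT infinite volume, NOT a mass gap, NOT Clay).  Width seat
`ym-ust-20520-w3` (gen 20, LEAD-20520 by lineage); `--supports stmt-QuantumFields-20520 --as helper`, count-neutral, definition-free, default heartbeats.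

WHAT THIS IS.  ✓`…PolymerMayerGas.exists_localized_log_gas` (the last Mayer step, abstract over configurations `U : ι → G`, for the `TTouch`-gas of face-connected
cube polymers of `TPt 3 N` with small local REAL activities `ρ Z U`, [Balaban1988RG2Cluster] (2.11)–(2.13) p.14 + (2.41) p.21 + [KoteckyPreiss1986]) delivers its
analytic interpolations (iii) only along ONE-COORDINATE MOVES of the window, from interpolating activity families GIVEN for such moves — the currency of LINE g24-3's
POLYᵃ∘.  LINE g24-4 «background_form» (ideator g24; junctions lifted as ✓`…BackgroundFormKnit`) wants instead LIPSCHITZ and DISCRETE-C^{1,1} moduli of the terms in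
BACKGROUND variables along ARBITRARY window pairs and squares — which one gets from analytic interpolations along an arbitrary complex LINE (Schwarz: w5 g20's
✓`…BackgroundFormCauchyShape.norm_sub_le_two_mul_div_of_differentiableOn` (p775626)) and along a complex BIDISC through four corners (two-parameter Schwarz
`…CauchyShape.norm_mixedDiff_le_of_differentiableOn_ball₂`, slice-analyticity suffices).  This file is that FAMILIES EDITION of the Mayer step, with the SAME
letters minus `hana` (the families are now supplied per pair ∕ per square, with their own radii, INSIDE the conclusion):
★★★ `exists_localized_log_gas_families`: `∃ T` (the same witness `T Y U := Re E(Y)` on face-connected `Y`, else `0`) with (i) locality through the cube map `q`,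
(ii) support on `TFaceConnected`, (iii₁) for EVERY pair `U, V ∈ S`, every radius `Rad` and every activity family `k Z : ℂ → ℂ` complex-differentiable on `ball 0 Rad`
with the activity majorant `A·e^{−R·d(Z)}` there and `k Z 0 = ρ Z U`, `k Z 1 = ρ Z V`: an interpolation `g` of `T Y`, differentiable on `ball 0 Rad`,
`‖g z‖ ≤ e·ν·c₁·K₀²·A·e^{−r₁·d(Y)}`, `g 0 = T Y U`, `g 1 = T Y V`; (iii₂) for EVERY four corners `U₀₀ U₁₀ U₀₁ U₁₁ ∈ S`, radii `Rad₁ Rad₂` and two-parameter family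
`k Z : ℂ → ℂ → ℂ` SLICE-differentiable (`z`-slices on `ball 0 Rad₁` for `w ∈ ball 0 Rad₂`, `w`-slices on `ball 0 Rad₂` for `z ∈ ball 0 Rad₁`) with the majorant on the
bidisc and the four corner values: a two-parameter interpolation `g` of `T Y`, slice-differentiable likewise, same bound on the bidisc, `g 0 0 = T Y U₀₀`, `g 1 0 = T Y U₁₀`,
`g 0 1 = T Y U₀₁`, `g 1 1 = T Y U₁₁` — exactly the hypotheses `hg0 ∕ hg1 ∕ hgw ∕ hB` of `norm_mixedDiff_le_of_differentiableOn_ball₂` after specialising `w = 0, 1`;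
(iv) `0 < Re Ξ(U)` and `log Re Ξ(U) = Σ_Y T Y U` on `S`.  Proof: the (2.41) analytic face Summits ✓`…Spine.NE1p.analytic_and_bounded_locE_param_of_geometry` over lit
✓`tgeometry 3 N` applied to each one-parameter slice, KP realness (✓`…PolymerMayerGas.isKPVolume_tgeometry`, `locE_im_eq_zero`) at the corners, and §1–§2 of
✓`…PolymerMayerGas` for (iv).  §1 = the two reusable pieces (`locE_empty_eq_zero`, `locE_eq_cast_re`) and the per-pair ∕ per-square cores
★`exists_interpolant_of_family`, ★`exists_interpolant₂_of_family` (stated for the explicit witness); §2 = the theorem; §3 = ★★★ `exists_localized_log_gas_moduli`,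
the MODULI edition ((v) `|T Y U − T Y V| ≤ 2·B_E(Y)∕Rad`, (vi) `|T Y U₁₁ − T Y U₁₀ − T Y U₀₁ + T Y U₀₀| ≤ 4·B_E(Y)∕(Rad₁Rad₂)`) by w5 g20's Schwarz lemmas
✓`…BackgroundFormCauchyShape.{norm_sub_le_two_mul_div_of_differentiableOn, norm_mixedDiff_le_of_differentiableOn_ball₂'}`.

USE (LINE g24-4's load-bearing (a) in background currency; LINE g24-3 unchanged): activities of the last large-field strata that are complex-analytic functions of the
background variables on a domain `D` stable under the affine lines `a + z•v` (`‖v‖ < ρ`, `|z| < ρ∕‖v‖`) give, through (iii₁) with `Rad := ρ∕‖v‖` and Schwarz, terms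
`T Y` LIPSCHITZ with modulus `(2∕ρ)·e·ν·c₁·K₀²·A·e^{−r₁ d(Y)}`, and through (iii₂) + the two-parameter Schwarz, DISCRETE-C^{1,1} — BGFORM∘'s (lip)∕(C11) shape for
the gas part, docking via ✓`…BackgroundFormAlgebra.oneBond_le_of_sensitivity` ∕ `fourPoint_le_of_sensitivity`.  That knit is NOT in this file.

HONEST: an abstract theorem about polymer gases on `tsys 3 N`; no Bałaban density, action or renormalisation map appears; nothing of Bałaban's is asserted; BGFORM∘,
BAL-GAS∘, POLYᵃ∘, S2β, `FluctuationComparisonRegPrIntL` (20520) and `YM3TorusSU2` are NOT proved; registry v11.4 and its five stubs untouched (0∕5).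
[cite: Balaban1988RG2Cluster, (2.11)-(2.13) p.14 and (2.41) p.21; KoteckyPreiss1986, Theorem p.492; Balaban1985Variational, Prop. 9 p.309 and (190) p.308; Balaban1987RG1, (1.11)-(1.14) p.262]
-/

set_option autoImplicit false

noncomputable section

namespace Summit.QuantumFields.YangMills.Theorems.FluctuationComparisonRegPrIntLPolymerMayerGasFamilies

open scoped BigOperators
open Literature.MathematicalPhysics.QuantumFieldTheory.Balaban1983to89 (LocDomainSys)
open Literature.MathematicalPhysics.QuantumFieldTheory.Balaban1983to89.TreeLengthTorus (TPt TDom IsTDom tsys TFaceConnected TLinked TStepIn torusTreeLen torusTreeLen_nonneg)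
open Literature.MathematicalPhysics.QuantumFieldTheory.Balaban1983to89.TreeLengthTorusGeometry (TTouch tgeometry ttouch_refl ttouch_symm)
open Literature.MathematicalPhysics.QuantumFieldTheory.Balaban1983to89.B13Resummation (locE locE_congr logZ_eq_sum_locE kp_condition exp_sum_locE_eq_Z)
open Literature.MathematicalPhysics.QuantumFieldTheory.Balaban1983to89.B13FamilySum (coveringFamilies mem_coveringFamilies)
open Literature.MathematicalPhysics.QuantumFieldTheory.Balaban1983to89.B12TreeDecay (kappa₀ K₀)
open Literature.Probability.LatticeModels
open Summit.QuantumFields.BalabanUV.T4Continuum.NE1p.DressedOutputAnalyticFaces (analytic_and_bounded_locE_param_of_geometry)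
open Summit.QuantumFields.YangMills.Theorems.FluctuationComparisonRegPrIntLPolymerMayerGas
open Summit.QuantumFields.YangMills.Theorems.FluctuationComparisonRegPrIntLBackgroundFormCauchyShape (norm_sub_le_two_mul_div_of_differentiableOn norm_mixedDiff_le_of_differentiableOn_ball₂')

variable {N : ℕ} [NeZero N]

/-! ## §1 Two reusable pieces and the per-pair ∕ per-square cores -/

open Classical in
/-- `E(∅) = 0`: no non-empty domain lies inside the empty cube set, so the only covering family is the empty one, whose truncated functional vanishes
(lit ✓`polymerLogZ_empty`). [cite: Balaban1988RG2Cluster, (2.13) p.14] -/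
theorem locE_empty_eq_zero (w : TDom 3 N → ℂ) : locE TTouch (fun Z : TDom 3 N => Z.1) w ∅ = 0 := by
  haveI : Std.Refl (TTouch (d := 3) (N := N)) := ⟨ttouch_refl⟩
  haveI : Std.Symm (TTouch (d := 3) (N := N)) := ⟨ttouch_symm⟩
  unfold locE
  refine Finset.sum_eq_zero fun C hC => ?_
  obtain ⟨-, hCY⟩ := mem_coveringFamilies.1 hC
  have hCe : C = ∅ := by
    rw [Finset.eq_empty_iff_forall_notMem]
    intro Z hZ
    obtain ⟨x, hx⟩ := Z.2.1
    have : x ∈ C.biUnion (fun Z : TDom 3 N => Z.1) := Finset.mem_biUnion.2 ⟨Z, hZ, hx⟩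
    rw [hCY] at this
    exact Finset.notMem_empty x this
  subst hCe
  unfold truncatedWeight
  simp [polymerLogZ_empty]

open Classical in
/-- At a REAL activity vector in the printed regime (`|w₀ Z| ≤ A·e^{−R·d(Z)}`, hence KP by ✓`isKPVolume_tgeometry`) the localized functional is real
(✓`locE_im_eq_zero`), so any complex activity vector that coincides with it pointwise has `E(Y)` equal to the cast of `Re E(Y)` (✓`locE_congr`).
[cite: KoteckyPreiss1986, Theorem p.492; Balaban1988RG2Cluster, (2.13) p.14] -/
theorem locE_eq_cast_re {A R r₁ : ℝ} (hA : 0 ≤ A) (hr₁ : 0 ≤ r₁)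
    (hrate : r₁ + 2 * (tgeometry 3 N).κ₀ + 2 ≤ R)
    (hsmall : A * Real.exp (5 * r₁ + 1) * (tgeometry 3 N).K₀ * (tgeometry 3 N).ν * (tgeometry 3 N).c₁ ≤ 1)
    {w₀ : TDom 3 N → ℝ} (hw₀ : ∀ Z, |w₀ Z| ≤ A * Real.exp (-(R * torusTreeLen Z.1)))
    {w : TDom 3 N → ℂ} (hw : ∀ Z, w Z = (w₀ Z : ℂ)) (Y : Finset (TPt 3 N)) :
    locE TTouch (fun Z : TDom 3 N => Z.1) w Y = (((locE TTouch (fun Z : TDom 3 N => Z.1) (fun Z => (w₀ Z : ℂ)) Y).re : ℝ) : ℂ) := by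
  haveI : Std.Refl (TTouch (d := 3) (N := N)) := ⟨ttouch_refl⟩
  haveI : Std.Symm (TTouch (d := 3) (N := N)) := ⟨ttouch_symm⟩
  have hcongr : locE TTouch (fun Z : TDom 3 N => Z.1) w Y = locE TTouch (fun Z : TDom 3 N => Z.1) (fun Z => (w₀ Z : ℂ)) Y :=
    locE_congr TTouch fun Z _ => hw Z
  have hKP := isKPVolume_tgeometry (N := N) (w := fun Z => (w₀ Z : ℂ)) hA hr₁ hrate hsmall fun Z => by
    rw [Complex.norm_real, Real.norm_eq_abs]; exact hw₀ Z
  have him := locE_im_eq_zero hKP (fun Z => Complex.ofReal_im _) Y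
  rw [hcongr]
  exact (Complex.ext (Complex.ofReal_re _) (by simpa using him.symm)).symm

open Classical in
/-- ★ **PER-PAIR CORE (one complex parameter).**  For two window configurations `U, V ∈ S` and ANY activity family `k Z` complex-differentiable on `ball 0 Rad` with the
activity majorant there and `k Z 0 = ρ Z U`, `k Z 1 = ρ Z V`, the explicit term `T Y := Re E(Y)` (on face-connected `Y`, else `0`) has an interpolation `g z := E_z(Y)`,
differentiable on `ball 0 Rad`, `‖g z‖ ≤ e·ν·c₁·K₀²·A·e^{−r₁ d(Y)}`, `g 0 = T Y U`, `g 1 = T Y V` — (2.41) + [KP86] holomorphy over `tgeometry 3 N`, uniformly in `z`.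
No one-coordinate restriction on the pair. [cite: Balaban1988RG2Cluster, (2.41) p.21; KoteckyPreiss1986, Theorem p.492] -/
theorem exists_interpolant_of_family {ι G : Type*} (S : Set (ι → G)) (ρ : TDom 3 N → (ι → G) → ℝ) {A R r₁ : ℝ}
    (hA : 0 ≤ A) (hr₁ : 0 ≤ r₁) (hrate : r₁ + 2 * (tgeometry 3 N).κ₀ + 2 ≤ R)
    (hsmall : A * Real.exp (5 * r₁ + 1) * (tgeometry 3 N).K₀ * (tgeometry 3 N).ν * (tgeometry 3 N).c₁ ≤ 1)
    (hbound : ∀ Z, ∀ U ∈ S, |ρ Z U| ≤ A * Real.exp (-(R * torusTreeLen Z.1)))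
    (Rad : ℝ) {U V : ι → G} (hU : U ∈ S) (hV : V ∈ S) (k : TDom 3 N → ℂ → ℂ)
    (hkd : ∀ Z, DifferentiableOn ℂ (k Z) (Metric.ball 0 Rad))
    (hkb : ∀ Z, ∀ z ∈ Metric.ball (0 : ℂ) Rad, ‖k Z z‖ ≤ A * Real.exp (-(R * torusTreeLen Z.1)))
    (hk0 : ∀ Z, k Z 0 = (ρ Z U : ℂ)) (hk1 : ∀ Z, k Z 1 = (ρ Z V : ℂ)) (Y : Finset (TPt 3 N)) :
    ∃ g : ℂ → ℂ, DifferentiableOn ℂ g (Metric.ball 0 Rad) ∧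
      (∀ z ∈ Metric.ball (0 : ℂ) Rad, ‖g z‖ ≤
        Real.exp 1 * (tgeometry 3 N).ν * (tgeometry 3 N).c₁ * (tgeometry 3 N).K₀ ^ 2 * A * Real.exp (-r₁ * torusTreeLen Y)) ∧
      g 0 = ((if TFaceConnected Y then (locE TTouch (fun Z : TDom 3 N => Z.1) (fun Z => (ρ Z U : ℂ)) Y).re else 0 : ℝ) : ℂ) ∧
      g 1 = ((if TFaceConnected Y then (locE TTouch (fun Z : TDom 3 N => Z.1) (fun Z => (ρ Z V : ℂ)) Y).re else 0 : ℝ) : ℂ) := by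
  have hK₀ : 0 ≤ (tgeometry 3 N).K₀ := (tgeometry 3 N).K₀_nonneg
  have hν : 0 ≤ (tgeometry 3 N).ν := (tgeometry 3 N).ν_nonneg
  have hc₁ : 0 ≤ (tgeometry 3 N).c₁ := (tgeometry 3 N).c₁_nonneg
  by_cases hYc : TFaceConnected Y
  · rcases Y.eq_empty_or_nonempty with hYe | hYne
    · subst hYe
      refine ⟨fun _ => 0, differentiableOn_const 0, fun z _ => ?_, ?_, ?_⟩
      · rw [norm_zero]; positivity
      · rw [if_pos hYc, locE_empty_eq_zero]; simp
      · rw [if_pos hYc, locE_empty_eq_zero]; simp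
    · set X₀ : TDom 3 N := ⟨Y, hYne, hYc⟩ with hX₀
      have hface := analytic_and_bounded_locE_param_of_geometry (tgeometry 3 N) (m := fun Z => A * Real.exp (-(R * (tsys 3 N).dj Z)))
        (act := fun z Z => k Z z) (A := A) (R := R) (r₁ := r₁) X₀ (U := Metric.ball (0 : ℂ) Rad) Metric.isOpen_ball hA hr₁
        hrate hsmall (fun Z _ => hkd Z) (fun z hz Z _ => hkb Z z hz) (fun Z _ => le_rfl)
      obtain ⟨hdiff, hbd⟩ := hface
      refine ⟨fun z => locE TTouch (fun Z : TDom 3 N => Z.1) (fun Z => k Z z) Y, hdiff, fun z hz => by rw [neg_mul]; exact hbd z hz, ?_, ?_⟩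
      · rw [if_pos hYc]; exact locE_eq_cast_re hA hr₁ hrate hsmall (fun Z => hbound Z U hU) (fun Z => hk0 Z) Y
      · rw [if_pos hYc]; exact locE_eq_cast_re hA hr₁ hrate hsmall (fun Z => hbound Z V hV) (fun Z => hk1 Z) Y
  · refine ⟨fun _ => 0, differentiableOn_const 0, fun z _ => ?_, ?_, ?_⟩
    · rw [norm_zero]; positivity
    · rw [if_neg hYc]; simp
    · rw [if_neg hYc]; simp

open Classical in
/-- ★ **PER-SQUARE CORE (two complex parameters, slice-analytic).**  For four window corners `U₀₀ U₁₀ U₀₁ U₁₁ ∈ S` and ANY two-parameter activity family `k Z : ℂ → ℂ → ℂ`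
whose `z`-slices are differentiable on `ball 0 Rad₁` (for `w ∈ ball 0 Rad₂`) and `w`-slices on `ball 0 Rad₂` (for `z ∈ ball 0 Rad₁`), with the activity majorant on the
bidisc and the four corner values, the explicit term `T Y` has the two-parameter interpolation `g z w := E_{z,w}(Y)`: slice-differentiable likewise, bounded by
`e·ν·c₁·K₀²·A·e^{−r₁ d(Y)}` on the bidisc, with the four corner values of `T Y` — the hypotheses of the two-parameter Schwarz corollary.  (2.41) + [KP86] holomorphy,
one slice at a time. [cite: Balaban1988RG2Cluster, (2.41) p.21; KoteckyPreiss1986, Theorem p.492; Balaban1985Variational, (190) p.308] -/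
theorem exists_interpolant₂_of_family {ι G : Type*} (S : Set (ι → G)) (ρ : TDom 3 N → (ι → G) → ℝ) {A R r₁ : ℝ}
    (hA : 0 ≤ A) (hr₁ : 0 ≤ r₁) (hrate : r₁ + 2 * (tgeometry 3 N).κ₀ + 2 ≤ R)
    (hsmall : A * Real.exp (5 * r₁ + 1) * (tgeometry 3 N).K₀ * (tgeometry 3 N).ν * (tgeometry 3 N).c₁ ≤ 1)
    (hbound : ∀ Z, ∀ U ∈ S, |ρ Z U| ≤ A * Real.exp (-(R * torusTreeLen Z.1)))
    (Rad₁ Rad₂ : ℝ) {U₀₀ U₁₀ U₀₁ U₁₁ : ι → G} (h₀₀ : U₀₀ ∈ S) (h₁₀ : U₁₀ ∈ S) (h₀₁ : U₀₁ ∈ S) (h₁₁ : U₁₁ ∈ S)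
    (k : TDom 3 N → ℂ → ℂ → ℂ)
    (hkz : ∀ Z, ∀ w ∈ Metric.ball (0 : ℂ) Rad₂, DifferentiableOn ℂ (fun z => k Z z w) (Metric.ball 0 Rad₁))
    (hkw : ∀ Z, ∀ z ∈ Metric.ball (0 : ℂ) Rad₁, DifferentiableOn ℂ (fun w => k Z z w) (Metric.ball 0 Rad₂))
    (hkb : ∀ Z, ∀ z ∈ Metric.ball (0 : ℂ) Rad₁, ∀ w ∈ Metric.ball (0 : ℂ) Rad₂, ‖k Z z w‖ ≤ A * Real.exp (-(R * torusTreeLen Z.1)))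
    (hk00 : ∀ Z, k Z 0 0 = (ρ Z U₀₀ : ℂ)) (hk10 : ∀ Z, k Z 1 0 = (ρ Z U₁₀ : ℂ))
    (hk01 : ∀ Z, k Z 0 1 = (ρ Z U₀₁ : ℂ)) (hk11 : ∀ Z, k Z 1 1 = (ρ Z U₁₁ : ℂ)) (Y : Finset (TPt 3 N)) :
    ∃ g : ℂ → ℂ → ℂ,
      (∀ w ∈ Metric.ball (0 : ℂ) Rad₂, DifferentiableOn ℂ (fun z => g z w) (Metric.ball 0 Rad₁)) ∧
      (∀ z ∈ Metric.ball (0 : ℂ) Rad₁, DifferentiableOn ℂ (g z) (Metric.ball 0 Rad₂)) ∧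
      (∀ z ∈ Metric.ball (0 : ℂ) Rad₁, ∀ w ∈ Metric.ball (0 : ℂ) Rad₂, ‖g z w‖ ≤
        Real.exp 1 * (tgeometry 3 N).ν * (tgeometry 3 N).c₁ * (tgeometry 3 N).K₀ ^ 2 * A * Real.exp (-r₁ * torusTreeLen Y)) ∧
      g 0 0 = ((if TFaceConnected Y then (locE TTouch (fun Z : TDom 3 N => Z.1) (fun Z => (ρ Z U₀₀ : ℂ)) Y).re else 0 : ℝ) : ℂ) ∧
      g 1 0 = ((if TFaceConnected Y then (locE TTouch (fun Z : TDom 3 N => Z.1) (fun Z => (ρ Z U₁₀ : ℂ)) Y).re else 0 : ℝ) : ℂ) ∧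
      g 0 1 = ((if TFaceConnected Y then (locE TTouch (fun Z : TDom 3 N => Z.1) (fun Z => (ρ Z U₀₁ : ℂ)) Y).re else 0 : ℝ) : ℂ) ∧
      g 1 1 = ((if TFaceConnected Y then (locE TTouch (fun Z : TDom 3 N => Z.1) (fun Z => (ρ Z U₁₁ : ℂ)) Y).re else 0 : ℝ) : ℂ) := by
  have hK₀ : 0 ≤ (tgeometry 3 N).K₀ := (tgeometry 3 N).K₀_nonneg
  have hν : 0 ≤ (tgeometry 3 N).ν := (tgeometry 3 N).ν_nonneg
  have hc₁ : 0 ≤ (tgeometry 3 N).c₁ := (tgeometry 3 N).c₁_nonneg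
  by_cases hYc : TFaceConnected Y
  · rcases Y.eq_empty_or_nonempty with hYe | hYne
    · subst hYe
      refine ⟨fun _ _ => 0, fun w _ => differentiableOn_const 0, fun z _ => differentiableOn_const 0, fun z _ w _ => ?_, ?_, ?_, ?_, ?_⟩
      · rw [norm_zero]; positivity
      all_goals rw [if_pos hYc, locE_empty_eq_zero]; simp
    · set X₀ : TDom 3 N := ⟨Y, hYne, hYc⟩ with hX₀
      -- the `z`-slices: for each `w` in the second disc, the one-parameter family `z ↦ k Z z w`
      have hzs : ∀ w ∈ Metric.ball (0 : ℂ) Rad₂,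
          DifferentiableOn ℂ (fun z => locE TTouch (fun Z : TDom 3 N => Z.1) (fun Z => k Z z w) Y) (Metric.ball 0 Rad₁) := by
        intro w hw
        have hface := analytic_and_bounded_locE_param_of_geometry (tgeometry 3 N) (m := fun Z => A * Real.exp (-(R * (tsys 3 N).dj Z)))
          (act := fun z Z => k Z z w) (A := A) (R := R) (r₁ := r₁) X₀ (U := Metric.ball (0 : ℂ) Rad₁) Metric.isOpen_ball hA hr₁
          hrate hsmall (fun Z _ => hkz Z w hw) (fun z hz Z _ => hkb Z z hz w hw) (fun Z _ => le_rfl)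
        exact hface.1
      -- the `w`-slices: for each `z` in the first disc, the one-parameter family `w ↦ k Z z w` (analyticity AND the bound)
      have hws : ∀ z ∈ Metric.ball (0 : ℂ) Rad₁,
          DifferentiableOn ℂ (fun w => locE TTouch (fun Z : TDom 3 N => Z.1) (fun Z => k Z z w) Y) (Metric.ball 0 Rad₂) ∧
          ∀ w ∈ Metric.ball (0 : ℂ) Rad₂, ‖locE TTouch (fun Z : TDom 3 N => Z.1) (fun Z => k Z z w) Y‖ ≤
            Real.exp 1 * (tgeometry 3 N).ν * (tgeometry 3 N).c₁ * (tgeometry 3 N).K₀ ^ 2 * A * Real.exp (-r₁ * torusTreeLen Y) := by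
        intro z hz
        have hface := analytic_and_bounded_locE_param_of_geometry (tgeometry 3 N) (m := fun Z => A * Real.exp (-(R * (tsys 3 N).dj Z)))
          (act := fun w Z => k Z z w) (A := A) (R := R) (r₁ := r₁) X₀ (U := Metric.ball (0 : ℂ) Rad₂) Metric.isOpen_ball hA hr₁
          hrate hsmall (fun Z _ => hkw Z z hz) (fun w hw Z _ => hkb Z z hz w hw) (fun Z _ => le_rfl)
        obtain ⟨hdiff, hbd⟩ := hface
        exact ⟨hdiff, fun w hw => by rw [neg_mul]; exact hbd w hw⟩
      refine ⟨fun z w => locE TTouch (fun Z : TDom 3 N => Z.1) (fun Z => k Z z w) Y, hzs, fun z hz => (hws z hz).1,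
        fun z hz w hw => (hws z hz).2 w hw, ?_, ?_, ?_, ?_⟩
      · rw [if_pos hYc]; exact locE_eq_cast_re hA hr₁ hrate hsmall (fun Z => hbound Z U₀₀ h₀₀) (fun Z => hk00 Z) Y
      · rw [if_pos hYc]; exact locE_eq_cast_re hA hr₁ hrate hsmall (fun Z => hbound Z U₁₀ h₁₀) (fun Z => hk10 Z) Y
      · rw [if_pos hYc]; exact locE_eq_cast_re hA hr₁ hrate hsmall (fun Z => hbound Z U₀₁ h₀₁) (fun Z => hk01 Z) Y
      · rw [if_pos hYc]; exact locE_eq_cast_re hA hr₁ hrate hsmall (fun Z => hbound Z U₁₁ h₁₁) (fun Z => hk11 Z) Y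
  · refine ⟨fun _ _ => 0, fun w _ => differentiableOn_const 0, fun z _ => differentiableOn_const 0, fun z _ w _ => ?_, ?_, ?_, ?_, ?_⟩
    · rw [norm_zero]; positivity
    all_goals rw [if_neg hYc]; simp

/-! ## §2 The theorem -/

open Classical in
/-- ★★★ **THE LAST MAYER STEP ON T³ — FAMILIES EDITION.**  Same polymer gas and letters as ✓`…PolymerMayerGas.exists_localized_log_gas` (REAL activities `ρ Z U`, LOCAL
through the cube map `q`, SMALL on the window `S`: `|ρ Z U| ≤ A·e^{−R·d(Z)}`, regime `r₁ + 2κ₀ + 2 ≤ R`, `A·e^{5r₁+1}·K₀·ν·c₁ ≤ 1`) WITHOUT the one-coordinate analyticity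
letter; conclusion `∃ T` with (i) locality, (ii) support on face-connected polymers, (iii₁) analytic interpolation of `T Y` along EVERY one-parameter activity family
through a window pair (any radius), (iii₂) slice-analytic two-parameter interpolation of `T Y` through EVERY square of four window corners (any radii) — both with the
majorant `e·ν·c₁·K₀²·A·Real.exp (-r₁ * d(Y))` — and (iv) `0 < Re Ξ(U)`, `log Re Ξ(U) = Σ_Y T Y U` on `S`.  With Schwarz (one and two parameters) these give Lipschitz
and discrete-C^{1,1} moduli of the gas terms along complex-analytic directions of the activities (LINE g24-4's currency); with one-bond families they give back (iii) of
the pairs' predecessor (LINE g24-3's currency). [cite: Balaban1988RG2Cluster, (2.11)-(2.13) p.14 and (2.41) p.21; KoteckyPreiss1986, Theorem p.492; Balaban1985Variational, Prop. 9 p.309 and (190) p.308] -/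
theorem exists_localized_log_gas_families {ι G : Type*} (q : ι → TPt 3 N) (S : Set (ι → G))
    (ρ : TDom 3 N → (ι → G) → ℝ) {A R r₁ : ℝ} (hA : 0 ≤ A) (hr₁ : 0 ≤ r₁)
    (hrate : r₁ + 2 * (tgeometry 3 N).κ₀ + 2 ≤ R)
    (hsmall : A * Real.exp (5 * r₁ + 1) * (tgeometry 3 N).K₀ * (tgeometry 3 N).ν * (tgeometry 3 N).c₁ ≤ 1)
    (hbound : ∀ Z, ∀ U ∈ S, |ρ Z U| ≤ A * Real.exp (-(R * torusTreeLen Z.1)))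
    (hloc : ∀ Z U V, (∀ i, q i ∈ Z.1 → U i = V i) → ρ Z U = ρ Z V) :
    ∃ T : Finset (TPt 3 N) → (ι → G) → ℝ,
      (∀ Y U V, (∀ i, q i ∈ Y → U i = V i) → T Y U = T Y V) ∧
      (∀ Y, ¬ TFaceConnected Y → ∀ U, T Y U = 0) ∧
      (∀ (Rad : ℝ) (U V : ι → G), U ∈ S → V ∈ S → ∀ k : TDom 3 N → ℂ → ℂ,
        (∀ Z, DifferentiableOn ℂ (k Z) (Metric.ball 0 Rad)) →
        (∀ Z, ∀ z ∈ Metric.ball (0 : ℂ) Rad, ‖k Z z‖ ≤ A * Real.exp (-(R * torusTreeLen Z.1))) →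
        (∀ Z, k Z 0 = (ρ Z U : ℂ)) → (∀ Z, k Z 1 = (ρ Z V : ℂ)) → ∀ Y : Finset (TPt 3 N),
        ∃ g : ℂ → ℂ, DifferentiableOn ℂ g (Metric.ball 0 Rad) ∧
          (∀ z ∈ Metric.ball (0 : ℂ) Rad, ‖g z‖ ≤
            Real.exp 1 * (tgeometry 3 N).ν * (tgeometry 3 N).c₁ * (tgeometry 3 N).K₀ ^ 2 * A * Real.exp (-r₁ * torusTreeLen Y)) ∧
          g 0 = (T Y U : ℂ) ∧ g 1 = (T Y V : ℂ)) ∧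
      (∀ (Rad₁ Rad₂ : ℝ) (U₀₀ U₁₀ U₀₁ U₁₁ : ι → G), U₀₀ ∈ S → U₁₀ ∈ S → U₀₁ ∈ S → U₁₁ ∈ S → ∀ k : TDom 3 N → ℂ → ℂ → ℂ,
        (∀ Z, ∀ w ∈ Metric.ball (0 : ℂ) Rad₂, DifferentiableOn ℂ (fun z => k Z z w) (Metric.ball 0 Rad₁)) →
        (∀ Z, ∀ z ∈ Metric.ball (0 : ℂ) Rad₁, DifferentiableOn ℂ (fun w => k Z z w) (Metric.ball 0 Rad₂)) →
        (∀ Z, ∀ z ∈ Metric.ball (0 : ℂ) Rad₁, ∀ w ∈ Metric.ball (0 : ℂ) Rad₂, ‖k Z z w‖ ≤ A * Real.exp (-(R * torusTreeLen Z.1))) →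
        (∀ Z, k Z 0 0 = (ρ Z U₀₀ : ℂ)) → (∀ Z, k Z 1 0 = (ρ Z U₁₀ : ℂ)) →
        (∀ Z, k Z 0 1 = (ρ Z U₀₁ : ℂ)) → (∀ Z, k Z 1 1 = (ρ Z U₁₁ : ℂ)) → ∀ Y : Finset (TPt 3 N),
        ∃ g : ℂ → ℂ → ℂ,
          (∀ w ∈ Metric.ball (0 : ℂ) Rad₂, DifferentiableOn ℂ (fun z => g z w) (Metric.ball 0 Rad₁)) ∧
          (∀ z ∈ Metric.ball (0 : ℂ) Rad₁, DifferentiableOn ℂ (g z) (Metric.ball 0 Rad₂)) ∧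
          (∀ z ∈ Metric.ball (0 : ℂ) Rad₁, ∀ w ∈ Metric.ball (0 : ℂ) Rad₂, ‖g z w‖ ≤
            Real.exp 1 * (tgeometry 3 N).ν * (tgeometry 3 N).c₁ * (tgeometry 3 N).K₀ ^ 2 * A * Real.exp (-r₁ * torusTreeLen Y)) ∧
          g 0 0 = (T Y U₀₀ : ℂ) ∧ g 1 0 = (T Y U₁₀ : ℂ) ∧ g 0 1 = (T Y U₀₁ : ℂ) ∧ g 1 1 = (T Y U₁₁ : ℂ)) ∧
      (∀ U ∈ S, 0 < (polymerPartitionFunction TTouch (fun Z : TDom 3 N => (ρ Z U : ℂ)) Finset.univ).re ∧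
        Real.log (polymerPartitionFunction TTouch (fun Z : TDom 3 N => (ρ Z U : ℂ)) Finset.univ).re = ∑ Y : Finset (TPt 3 N), T Y U) := by
  haveI : Std.Refl (TTouch (d := 3) (N := N)) := ⟨ttouch_refl⟩
  haveI : Std.Symm (TTouch (d := 3) (N := N)) := ⟨ttouch_symm⟩
  refine ⟨fun Y U => if TFaceConnected Y then (locE TTouch (fun Z : TDom 3 N => Z.1) (fun Z => (ρ Z U : ℂ)) Y).re else 0, ?_, ?_, ?_, ?_, ?_⟩
  · -- (i) locality, by `locE_congr`
    intro Y U V hUV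
    have h : locE TTouch (fun Z : TDom 3 N => Z.1) (fun Z => (ρ Z U : ℂ)) Y =
        locE TTouch (fun Z : TDom 3 N => Z.1) (fun Z => (ρ Z V : ℂ)) Y :=
      locE_congr TTouch fun Z hZ => by rw [hloc Z U V fun i hi => hUV i (hZ hi)]
    show (if TFaceConnected Y then (locE TTouch (fun Z : TDom 3 N => Z.1) (fun Z => (ρ Z U : ℂ)) Y).re else 0 : ℝ) =
      (if TFaceConnected Y then (locE TTouch (fun Z : TDom 3 N => Z.1) (fun Z => (ρ Z V : ℂ)) Y).re else 0 : ℝ)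
    rw [h]
  · -- (ii) support
    intro Y hY U
    show (if TFaceConnected Y then (locE TTouch (fun Z : TDom 3 N => Z.1) (fun Z => (ρ Z U : ℂ)) Y).re else 0 : ℝ) = 0
    rw [if_neg hY]
  · -- (iii₁) per-pair families
    intro Rad U V hU hV k hkd hkb hk0 hk1 Y
    exact exists_interpolant_of_family S ρ hA hr₁ hrate hsmall hbound Rad hU hV k hkd hkb hk0 hk1 Y
  · -- (iii₂) per-square two-parameter families
    intro Rad₁ Rad₂ U₀₀ U₁₀ U₀₁ U₁₁ h₀₀ h₁₀ h₀₁ h₁₁ k hkz hkw hkb hk00 hk10 hk01 hk11 Y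
    exact exists_interpolant₂_of_family S ρ hA hr₁ hrate hsmall hbound Rad₁ Rad₂ h₀₀ h₁₀ h₀₁ h₁₁ k hkz hkw hkb hk00 hk10 hk01 hk11 Y
  · -- (iv) `Ξ(U) > 0` and `log Ξ(U) = Σ_Y T Y U` on the window
    intro U hU
    have hwU : ∀ Z : TDom 3 N, ‖(ρ Z U : ℂ)‖ ≤ A * Real.exp (-(R * torusTreeLen Z.1)) := fun Z => by
      rw [Complex.norm_real, Real.norm_eq_abs]; exact hbound Z U hU
    have hKP := isKPVolume_tgeometry (N := N) (w := fun Z => (ρ Z U : ℂ)) hA hr₁ hrate hsmall hwU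
    obtain ⟨hpos, hlog⟩ := log_re_ppf_eq_sum_re_locE (w := fun Z => (ρ Z U : ℂ)) hA hr₁ hrate hsmall hwU (fun Z => Complex.ofReal_im _)
    refine ⟨hpos, hlog.trans (Finset.sum_congr rfl fun Y _ => ?_)⟩
    show (locE TTouch (fun Z : TDom 3 N => Z.1) (fun Z => (ρ Z U : ℂ)) Y).re =
      (if TFaceConnected Y then (locE TTouch (fun Z : TDom 3 N => Z.1) (fun Z => (ρ Z U : ℂ)) Y).re else 0 : ℝ)
    by_cases hYc : TFaceConnected Y
    · rw [if_pos hYc]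
    · rw [if_neg hYc]
      have hnot : ¬ IsTDom Y := fun h => hYc h.2
      have h0 := locE_eq_zero_of_not_isTDom hKP hnot
      exact (congrArg Complex.re h0).trans Complex.zero_re

/-! ## §3 The MODULI edition: Schwarz (one and two parameters, w5 g20's ✓`…BackgroundFormCauchyShape`) applied to (iii₁)∕(iii₂) -/

open Classical in
/-- ★★★ **THE LAST MAYER STEP ON T³ — MODULI EDITION.**  Same gas, same letters, same witness `T`; instead of interpolations the conclusion records the two
CAUCHY∕SCHWARZ consequences a background-form consumer wants: (v) for every window pair `U, V ∈ S` joined by an activity family analytic on `ball 0 Rad` with `1 < Rad`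
(activity majorant there): `|T Y U − T Y V| ≤ 2·(e·ν·c₁·K₀²·A·e^{−r₁ d(Y)})∕Rad` (one-parameter Schwarz ✓`…CauchyShape.norm_sub_le_two_mul_div_of_differentiableOn`);
(vi) for every square of corners `U₀₀ U₁₀ U₀₁ U₁₁ ∈ S` carried by a slice-analytic two-parameter family on `ball 0 Rad₁ × ball 0 Rad₂`, `1 < Radᵢ`:
`|T Y U₁₁ − T Y U₁₀ − T Y U₀₁ + T Y U₀₀| ≤ 4·(e·ν·c₁·K₀²·A·e^{−r₁ d(Y)})∕(Rad₁·Rad₂)` (two-parameter Schwarz ✓`…CauchyShape.norm_mixedDiff_le_of_differentiableOn_ball₂'`);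
plus (i) locality, (ii) support, (iv) the representation of `log Re Ξ` on `S`.  With `Rad := ρ∕‖move‖` these are the LIPSCHITZ and DISCRETE-C^{1,1} moduli of the gas
terms along analytic directions of the activities — the (lip)∕(C11) shape of LINE g24-4's BGFORM∘ for the gas part ([Balaban1985Variational] (190): «decay identical to
the propagator», read through Cauchy). [cite: Balaban1988RG2Cluster, (2.13) p.14 and (2.41) p.21; KoteckyPreiss1986, Theorem p.492; Balaban1987RG1, (1.11)-(1.14) p.262 and (0.25) p.257; Balaban1985Variational, Prop. 9 p.309 and (190) p.308] -/
theorem exists_localized_log_gas_moduli {ι G : Type*} (q : ι → TPt 3 N) (S : Set (ι → G))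
    (ρ : TDom 3 N → (ι → G) → ℝ) {A R r₁ : ℝ} (hA : 0 ≤ A) (hr₁ : 0 ≤ r₁)
    (hrate : r₁ + 2 * (tgeometry 3 N).κ₀ + 2 ≤ R)
    (hsmall : A * Real.exp (5 * r₁ + 1) * (tgeometry 3 N).K₀ * (tgeometry 3 N).ν * (tgeometry 3 N).c₁ ≤ 1)
    (hbound : ∀ Z, ∀ U ∈ S, |ρ Z U| ≤ A * Real.exp (-(R * torusTreeLen Z.1)))
    (hloc : ∀ Z U V, (∀ i, q i ∈ Z.1 → U i = V i) → ρ Z U = ρ Z V) :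
    ∃ T : Finset (TPt 3 N) → (ι → G) → ℝ,
      (∀ Y U V, (∀ i, q i ∈ Y → U i = V i) → T Y U = T Y V) ∧
      (∀ Y, ¬ TFaceConnected Y → ∀ U, T Y U = 0) ∧
      (∀ (Rad : ℝ), 1 < Rad → ∀ (U V : ι → G), U ∈ S → V ∈ S → ∀ k : TDom 3 N → ℂ → ℂ,
        (∀ Z, DifferentiableOn ℂ (k Z) (Metric.ball 0 Rad)) →
        (∀ Z, ∀ z ∈ Metric.ball (0 : ℂ) Rad, ‖k Z z‖ ≤ A * Real.exp (-(R * torusTreeLen Z.1))) →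
        (∀ Z, k Z 0 = (ρ Z U : ℂ)) → (∀ Z, k Z 1 = (ρ Z V : ℂ)) → ∀ Y : Finset (TPt 3 N),
        |T Y U - T Y V| ≤
          2 * (Real.exp 1 * (tgeometry 3 N).ν * (tgeometry 3 N).c₁ * (tgeometry 3 N).K₀ ^ 2 * A * Real.exp (-r₁ * torusTreeLen Y)) / Rad) ∧
      (∀ (Rad₁ Rad₂ : ℝ), 1 < Rad₁ → 1 < Rad₂ → ∀ (U₀₀ U₁₀ U₀₁ U₁₁ : ι → G), U₀₀ ∈ S → U₁₀ ∈ S → U₀₁ ∈ S → U₁₁ ∈ S →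
        ∀ k : TDom 3 N → ℂ → ℂ → ℂ,
        (∀ Z, ∀ w ∈ Metric.ball (0 : ℂ) Rad₂, DifferentiableOn ℂ (fun z => k Z z w) (Metric.ball 0 Rad₁)) →
        (∀ Z, ∀ z ∈ Metric.ball (0 : ℂ) Rad₁, DifferentiableOn ℂ (fun w => k Z z w) (Metric.ball 0 Rad₂)) →
        (∀ Z, ∀ z ∈ Metric.ball (0 : ℂ) Rad₁, ∀ w ∈ Metric.ball (0 : ℂ) Rad₂, ‖k Z z w‖ ≤ A * Real.exp (-(R * torusTreeLen Z.1))) →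
        (∀ Z, k Z 0 0 = (ρ Z U₀₀ : ℂ)) → (∀ Z, k Z 1 0 = (ρ Z U₁₀ : ℂ)) →
        (∀ Z, k Z 0 1 = (ρ Z U₀₁ : ℂ)) → (∀ Z, k Z 1 1 = (ρ Z U₁₁ : ℂ)) → ∀ Y : Finset (TPt 3 N),
        |T Y U₁₁ - T Y U₁₀ - T Y U₀₁ + T Y U₀₀| ≤
          4 * (Real.exp 1 * (tgeometry 3 N).ν * (tgeometry 3 N).c₁ * (tgeometry 3 N).K₀ ^ 2 * A * Real.exp (-r₁ * torusTreeLen Y)) / (Rad₁ * Rad₂)) ∧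
      (∀ U ∈ S, 0 < (polymerPartitionFunction TTouch (fun Z : TDom 3 N => (ρ Z U : ℂ)) Finset.univ).re ∧
        Real.log (polymerPartitionFunction TTouch (fun Z : TDom 3 N => (ρ Z U : ℂ)) Finset.univ).re = ∑ Y : Finset (TPt 3 N), T Y U) := by
  obtain ⟨T, hloc', hsupp, hone, htwo, hrep⟩ := exists_localized_log_gas_families q S ρ hA hr₁ hrate hsmall hbound hloc
  refine ⟨T, hloc', hsupp, ?_, ?_, hrep⟩
  · intro Rad hRad U V hU hV k hkd hkb hk0 hk1 Y
    obtain ⟨g, hg, hb, hg0, hg1⟩ := hone Rad U V hU hV k hkd hkb hk0 hk1 Y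
    have h1 : (1 : ℂ) ∈ Metric.ball (0 : ℂ) Rad := by
      rw [Metric.mem_ball, dist_zero_right, norm_one]; exact hRad
    have key := norm_sub_le_two_mul_div_of_differentiableOn hRad hg hb 1 h1
    rw [norm_one, mul_one, hg0, hg1, ← Complex.ofReal_sub, Complex.norm_real, Real.norm_eq_abs, abs_sub_comm] at key
    exact key
  · intro Rad₁ Rad₂ hR₁ hR₂ U₀₀ U₁₀ U₀₁ U₁₁ h₀₀ h₁₀ h₀₁ h₁₁ k hkz hkw hkb hk00 hk10 hk01 hk11 Y
    obtain ⟨g, hgz, hgw, hb, hg00, hg10, hg01, hg11⟩ :=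
      htwo Rad₁ Rad₂ U₀₀ U₁₀ U₀₁ U₁₁ h₀₀ h₁₀ h₀₁ h₁₁ k hkz hkw hkb hk00 hk10 hk01 hk11 Y
    have key := norm_mixedDiff_le_of_differentiableOn_ball₂' hR₁ hR₂ hgz hgw hb
    rw [hg00, hg10, hg01, hg11, ← Complex.ofReal_sub, ← Complex.ofReal_sub, ← Complex.ofReal_add, Complex.norm_real,
      Real.norm_eq_abs] at key
    exact key

end Summit.QuantumFields.YangMills.Theorems.FluctuationComparisonRegPrIntLPolymerMayerGasFamilies

end
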